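import Mathlib
import HarnessLib
import Summits.HubbardSuperconductivity.HubbardSuperconductivity.Theorems.KLProgrammeC4aSecondCumulantLines
import Summits.HubbardSuperconductivity.HubbardSuperconductivity.Theorems.KLProgrammeC4aTadpoleRepresentation
import Summits.HubbardSuperconductivity.HubbardSuperconductivity.Theorems.KLProgrammeKLRegimeWickBubbleChannels

/-!
# Route `KLProgramme` — crux C4a, S1 (c): the 4-LEG KERNEL OF THE SECOND CUMULANT AT THE TADPOLE LEGS — trees + bubbles, assembled;
# the model instance with the hard lines `C^K_{>Λ_n}`

Cell `gate-hubbard-kl`, lane hubbard-kl-c4a-1 (g6); helper for stub (C) `stub_twoLeg_curvature` of the engine-flow child `KLRegimeEngineV17F2`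
(stmt-HubbardSuperconductivity-20437); memo HOME/hubbard-kl-c4a-1/C4A-PLAN.md §22.10 (c).  With `W = V_U + 𝒩_K`, `W̃ = e^{Δ_C}W`, a covariance `C` with DIAGONAL
lines `contr C = diagContr ℓ`, and the tadpole legs `Z_{στ}(K,Q) = ((K,σ,+),(K,σ,−),(Q,τ,−),(Q,τ,+))`:

* §1 the dressed two-leg kernel is `kernel W̃ 2 = kernel 𝒩_K 2 + kernel (Δ_C V_U) 2` (frame + Hartree);
* §2 **the one-line trees** of `…C4aSecondCumulantDegree.kernel_four_secondCumulant_hubbardInteractionCT_explicit` at `Z_{στ}`: the bare vertex selects the line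
  momentum = the external momentum of the dressed leg, so `4(−T₀+T₁−T₂+T₃) = −[σ ≠ τ]·8c_U·(ℓ(K)·Σ̃(K,σ) + ℓ(Q)·Σ̃(Q,τ))`, `Σ̃(p,s) = kernel W̃ 2 (ψ̂⁺_{ps}, ψ̂⁻_{ps})`
  (`oneLine_tadpoleLegs`);
* §3 **assembly** (`kernel_four_secondCumulant_tadpoleLegs`, `sum_kernel_four_secondCumulant_tadpoleLegs`): per spin pair and summed over `(σ,τ)`,
  `Σ_{σ,τ} kernel₄(e^{Δ_C}(WW) − (e^{Δ_C}W)²)(Z_{στ}) = 96c_U²·(Σ_p ℓ(p)² − S_pp(K,Q) − 2·S_ph(K,Q)) − 8c_U·(ℓ(K)Σ_s Σ̃(K,s) + ℓ(Q)Σ_s Σ̃(Q,s))`,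
  `S_pp = Σ_{p,p′}[p + p′ ≐ K + Q]ℓℓ′`, `S_ph = Σ_{p,p′}[p + Q ≐ p′ + K]ℓℓ′`, `c_U = U(βL²)⁻³(4!)⁻¹`;
* §4 the model: `C = C^K_{>Λ_n} = klHardCov … n`, `ℓ(p) = χ_{Λ_n}(p)·βL²·ĝ_K(p)` (`contr_klHardCov_eq_diagContr`), and the continuum tadpole vertex of the second cumulant at
  lattice momenta (`tadpoleVertex_secondCumulant_latticeMomentum`) — the pp bubble at total frequency–momentum `(κ + p₀, k + q)`, the ph-crossed one at transfer
  `(κ − p₀, k − q)`, `κ = ±ω₀` the external frequency, `p₀` the slice frequency.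

Exact algebra; nothing about sizes; nothing asserts superconductivity.  References: Salmhofer 1999 §2.4 [cite: Salmhofer1999]; BGM 2006 §2.2–2.3 [cite: BenfattoGiulianiMastropietro2006].
-/

noncomputable section

namespace Summit.HubbardSuperconductivity.HubbardSuperconductivity.Theorems.C4a

set_option linter.dupNamespace false -- summit = problem name (single-conjunct summit), D-0017

open Literature.MathematicalPhysics.QuantumLattice Literature.Probability.LatticeModels GrassmannAlgebra Finset Matrix
open Summit.HubbardSuperconductivity.HubbardSuperconductivity.Theorems.KLRegimeWick
open Summit.HubbardSuperconductivity.HubbardSuperconductivity.Theorems.KLRegimeSplit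
open Summit.HubbardSuperconductivity.HubbardSuperconductivity.Theorems.KLProgrammeLegKernels
open Summit.HubbardSuperconductivity.HubbardSuperconductivity.Theorems.TwoPointAssembly

variable {L M : ℕ} [NeZero L]

/-! ## §1 The dressed two-leg kernel -/

/-- **The dressed two-leg kernel is frame + Hartree**: `kernel (e^{Δ_C}(V_U + 𝒩_K)) 2 X = kernel 𝒩_K 2 X + kernel (Δ_C V_U) 2 X` (degree bookkeeping:
`V_U` has no `2`-kernel, `Δ_C 𝒩_K` is a constant, `Δ_C²W` has no `2`-kernel). [cite: Salmhofer1999, §2.4] -/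
theorem kernel_two_gaussConv_hubbardInteractionCT (β U : ℝ) (K : TrigPolyC4v) (C : Matrix (HubbardFieldIdx L M) (HubbardFieldIdx L M) ℂ)
    (X : Fin 2 → HubbardFieldIdx L M) :
    kernel ℂ (gaussConv ℂ C (hubbardInteractionCT L M β U K)) 2 X =
      kernel ℂ (counterQuadratic L M β K) 2 X + kernel ℂ (grassmannLaplacian ℂ C (hubbardInteraction L M β U)) 2 X := by
  have h := kernel_gaussConv_sub_self_eq ℂ C (T := hubbardInteractionCT L M β U K) (m := 2)
    (fun j hj Y => kernel_hubbardInteractionCT_eq_zero_of_four_lt β U K (by omega) Y) X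
  have h4 : kernel ℂ (grassmannLaplacian ℂ C (grassmannLaplacian ℂ C (hubbardInteractionCT L M β U K))) 2 X = 0 :=
    kernel_grassmannLaplacian_eq_zero_of ℂ C (fun Y => kernel_four_grassmannLaplacian_hubbardInteractionCT β U K C Y) X
  have hN : kernel ℂ (grassmannLaplacian ℂ C (counterQuadratic L M β K)) 2 X = 0 :=
    kernel_grassmannLaplacian_eq_zero_of ℂ C (fun Y => kernel_counterQuadratic_of_ne_two β K (by norm_num) Y) X
  rw [kernel_sub', sub_eq_iff_eq_add, h4, mul_zero, add_zero] at h
  rw [h, hubbardInteractionCT, map_add, kernel_add, kernel_add, hN, add_zero, kernel_hubbardInteraction_of_ne_four β U (by norm_num) X, zero_add,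
    add_comm]

/-! ## §2 The one-line trees at the tadpole legs -/

section Trees

variable (β U : ℝ) (K : TrigPolyC4v) {C : Matrix (HubbardFieldIdx L M) (HubbardFieldIdx L M) ℂ} {ℓ : FreqMomentum L M → ℂ}

omit [NeZero L] in
/-- Conservation against a spectator in the middle: `n_a + n_x = n_x + n_b ∧ a⃗ + x⃗ = x⃗ + b⃗ ↔ a = b`. -/
theorem conserving_cancel_mid (a b x : FreqMomentum L M) :
    (matsubaraInt M a.1 + matsubaraInt M x.1 = matsubaraInt M x.1 + matsubaraInt M b.1 ∧ a.2 + x.2 = x.2 + b.2) ↔ a = b := by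
  rw [add_comm (matsubaraInt M x.1) (matsubaraInt M b.1), add_comm x.2 b.2]
  exact conserving_cancel_right a b x

omit [NeZero L] in
/-- Conservation against a spectator outside: `n_x + n_a = n_b + n_x ∧ x⃗ + a⃗ = b⃗ + x⃗ ↔ a = b`. -/
theorem conserving_cancel_outer (a b x : FreqMomentum L M) :
    (matsubaraInt M x.1 + matsubaraInt M a.1 = matsubaraInt M b.1 + matsubaraInt M x.1 ∧ x.2 + a.2 = b.2 + x.2) ↔ a = b := by
  rw [add_comm (matsubaraInt M x.1) (matsubaraInt M a.1), add_comm x.2 a.2]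
  exact conserving_cancel_right a b x

/-- **THE ONE-LINE TREES AT THE TADPOLE LEGS** (`contr C = diagContr ℓ`, `W̃ = e^{Δ_C}(V_U + 𝒩_K)`): the tree term of
`kernel_four_secondCumulant_hubbardInteractionCT_explicit` at `Z_{στ}(K,Q)` is `−[σ ≠ τ]·8c_U·(ℓ(K)·kernel W̃ 2 (ψ̂⁺_{Kσ}, ψ̂⁻_{Kσ}) + ℓ(Q)·kernel W̃ 2 (ψ̂⁺_{Qτ}, ψ̂⁻_{Qτ}))`:
each dressed leg carries the line at ITS OWN momentum (the bare vertex conserves), the loop of the tree is the self-energy insertion. [cite: Salmhofer1999, §2.4] -/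
theorem oneLine_tadpoleLegs (hC : contr ℂ C = diagContr L M ℓ) (Kx Q : FreqMomentum L M) (σ τ : Fin 2) :
    4 * (-(∑ X, ∑ Y, contr ℂ C X Y * (kernel ℂ (gaussConv ℂ C (hubbardInteractionCT L M β U K)) 2 ![X, ((Kx, σ), 0)] *
              kernel ℂ (gaussConv ℂ C (hubbardInteractionCT L M β U K)) 4 ![Y, ((Kx, σ), 1), ((Q, τ), 1), ((Q, τ), 0)])) +
            (∑ X, ∑ Y, contr ℂ C X Y * (kernel ℂ (gaussConv ℂ C (hubbardInteractionCT L M β U K)) 2 ![X, ((Kx, σ), 1)] *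
              kernel ℂ (gaussConv ℂ C (hubbardInteractionCT L M β U K)) 4 ![Y, ((Kx, σ), 0), ((Q, τ), 1), ((Q, τ), 0)])) -
            (∑ X, ∑ Y, contr ℂ C X Y * (kernel ℂ (gaussConv ℂ C (hubbardInteractionCT L M β U K)) 2 ![X, ((Q, τ), 1)] *
              kernel ℂ (gaussConv ℂ C (hubbardInteractionCT L M β U K)) 4 ![Y, ((Kx, σ), 0), ((Kx, σ), 1), ((Q, τ), 0)])) +
            (∑ X, ∑ Y, contr ℂ C X Y * (kernel ℂ (gaussConv ℂ C (hubbardInteractionCT L M β U K)) 2 ![X, ((Q, τ), 0)] *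
              kernel ℂ (gaussConv ℂ C (hubbardInteractionCT L M β U K)) 4 ![Y, ((Kx, σ), 0), ((Kx, σ), 1), ((Q, τ), 1)]))) =
      if σ = τ then 0 else
        -(8 * ((((U / (β * (L : ℝ) ^ 2) ^ 3 : ℝ)) : ℂ) * (((4 : ℕ).factorial : ℚ)⁻¹ • (1 : ℂ))) *
          (ℓ Kx * kernel ℂ (gaussConv ℂ C (hubbardInteractionCT L M β U K)) 2 ![((Kx, σ), 0), ((Kx, σ), 1)] +
            ℓ Q * kernel ℂ (gaussConv ℂ C (hubbardInteractionCT L M β U K)) 2 ![((Q, τ), 0), ((Q, τ), 1)])) := by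
  simp_rw [kernel_four_gaussConv_hubbardInteractionCT, hC, sum_diagContr_mul]
  set Wt := gaussConv ℂ C (hubbardInteractionCT L M β U K) with hWt
  set cU : ℂ := (((U / (β * (L : ℝ) ^ 2) ^ 3 : ℝ)) : ℂ) * (((4 : ℕ).factorial : ℚ)⁻¹ • (1 : ℂ)) with hcU
  have two : ∀ x : Fin 2, x = 0 ∨ x = 1 := by decide
  -- the four bare kernels with a wrong charge count
  have v0 : ∀ (p : FreqMomentum L M) (s : Fin 2), kernel ℂ (hubbardInteraction L M β U) 4 ![((p, s), 1), ((Kx, σ), 1), ((Q, τ), 1), ((Q, τ), 0)] = 0 :=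
    fun p s => kernel_hubbardInteraction_eq_zero_of_three_charges β U _ (i := 0) (j := 1) (k := 2) (by decide) (by decide) (by decide) rfl rfl
  have v1 : ∀ (p : FreqMomentum L M) (s : Fin 2), kernel ℂ (hubbardInteraction L M β U) 4 ![((p, s), 0), ((Kx, σ), 0), ((Q, τ), 1), ((Q, τ), 0)] = 0 :=
    fun p s => kernel_hubbardInteraction_eq_zero_of_three_charges β U _ (i := 0) (j := 1) (k := 3) (by decide) (by decide) (by decide) rfl rfl
  have v2 : ∀ (p : FreqMomentum L M) (s : Fin 2), kernel ℂ (hubbardInteraction L M β U) 4 ![((p, s), 0), ((Kx, σ), 0), ((Kx, σ), 1), ((Q, τ), 0)] = 0 :=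
    fun p s => kernel_hubbardInteraction_eq_zero_of_three_charges β U _ (i := 0) (j := 1) (k := 3) (by decide) (by decide) (by decide) rfl rfl
  have v3 : ∀ (p : FreqMomentum L M) (s : Fin 2), kernel ℂ (hubbardInteraction L M β U) 4 ![((p, s), 1), ((Kx, σ), 0), ((Kx, σ), 1), ((Q, τ), 1)] = 0 :=
    fun p s => kernel_hubbardInteraction_eq_zero_of_three_charges β U _ (i := 0) (j := 2) (k := 3) (by decide) (by decide) (by decide) rfl rfl
  -- the four surviving bare kernels: the line momentum is pinned to the dressed leg's momentum
  have e0 : ∀ (p : FreqMomentum L M) (s : Fin 2), kernel ℂ (hubbardInteraction L M β U) 4 ![((p, s), 0), ((Kx, σ), 1), ((Q, τ), 1), ((Q, τ), 0)] =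
      if σ ≠ τ ∧ s = σ ∧ Kx = p then -cU else 0 := by
    intro p s
    rw [kernel_hubbardInteraction_pmmp, kernel_hubbardInteraction_mmpp]
    simp only [conserving_cancel_right]
    by_cases hp : Kx = p
    · subst hp
      rcases two σ with rfl | rfl <;> rcases two τ with rfl | rfl <;> rcases two s with rfl | rfl <;> simp [hcU]
    · simp [hp]
  have e1 : ∀ (p : FreqMomentum L M) (s : Fin 2), kernel ℂ (hubbardInteraction L M β U) 4 ![((p, s), 1), ((Kx, σ), 0), ((Q, τ), 1), ((Q, τ), 0)] =
      if σ ≠ τ ∧ s = σ ∧ p = Kx then cU else 0 := by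
    intro p s
    rw [kernel_hubbardInteraction_mpmp, kernel_hubbardInteraction_mmpp]
    simp only [conserving_cancel_right]
    by_cases hp : p = Kx
    · subst hp
      rcases two σ with rfl | rfl <;> rcases two τ with rfl | rfl <;> rcases two s with rfl | rfl <;> simp [hcU]
    · simp [hp]
  have e2 : ∀ (p : FreqMomentum L M) (s : Fin 2), kernel ℂ (hubbardInteraction L M β U) 4 ![((p, s), 1), ((Kx, σ), 0), ((Kx, σ), 1), ((Q, τ), 0)] =
      if σ ≠ τ ∧ s = τ ∧ p = Q then -cU else 0 := by
    intro p s
    rw [kernel_hubbardInteraction_mpmp, kernel_hubbardInteraction_mmpp]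
    simp only [conserving_cancel_mid]
    by_cases hp : p = Q
    · subst hp
      rcases two σ with rfl | rfl <;> rcases two τ with rfl | rfl <;> rcases two s with rfl | rfl <;> simp [hcU]
    · simp [hp]
  have e3 : ∀ (p : FreqMomentum L M) (s : Fin 2), kernel ℂ (hubbardInteraction L M β U) 4 ![((p, s), 0), ((Kx, σ), 0), ((Kx, σ), 1), ((Q, τ), 1)] =
      if σ ≠ τ ∧ s = τ ∧ Q = p then cU else 0 := by
    intro p s
    rw [kernel_hubbardInteraction_ppmm, kernel_hubbardInteraction_mmpp]
    simp only [conserving_cancel_outer]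
    by_cases hp : Q = p
    · subst hp
      rcases two σ with rfl | rfl <;> rcases two τ with rfl | rfl <;> rcases two s with rfl | rfl <;> simp [hcU]
    · simp [hp]
  simp_rw [v0, v1, v2, v3, e0, e1, e2, e3, mul_zero, zero_sub, sub_zero]
  by_cases hστ : σ = τ
  · simp [hστ]
  rw [if_neg hστ]
  -- collapse the `(p, s)` sums onto the dressed leg
  have hs0 : ∀ f : FreqMomentum L M → Fin 2 → ℂ, ∑ p : FreqMomentum L M, ∑ s : Fin 2, ℓ p * (f p s * (if σ ≠ τ ∧ s = σ ∧ Kx = p then -cU else 0)) =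
      -(ℓ Kx * f Kx σ * cU) := by
    intro f
    rw [Finset.sum_eq_single Kx (fun p _ hp => by simp [Ne.symm hp]) (fun h => absurd (Finset.mem_univ _) h),
      Finset.sum_eq_single σ (fun s _ hs => by simp [hs]) (fun h => absurd (Finset.mem_univ _) h)]
    simp [hστ]; ring
  have hs1 : ∀ f : FreqMomentum L M → Fin 2 → ℂ, ∑ p : FreqMomentum L M, ∑ s : Fin 2, ℓ p * -(f p s * (if σ ≠ τ ∧ s = σ ∧ p = Kx then cU else 0)) =
      -(ℓ Kx * f Kx σ * cU) := by
    intro f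
    rw [Finset.sum_eq_single Kx (fun p _ hp => by simp [hp]) (fun h => absurd (Finset.mem_univ _) h),
      Finset.sum_eq_single σ (fun s _ hs => by simp [hs]) (fun h => absurd (Finset.mem_univ _) h)]
    simp [hστ, mul_assoc]
  have hs2 : ∀ f : FreqMomentum L M → Fin 2 → ℂ, ∑ p : FreqMomentum L M, ∑ s : Fin 2, ℓ p * -(f p s * (if σ ≠ τ ∧ s = τ ∧ p = Q then -cU else 0)) =
      ℓ Q * f Q τ * cU := by
    intro f
    rw [Finset.sum_eq_single Q (fun p _ hp => by simp [hp]) (fun h => absurd (Finset.mem_univ _) h),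
      Finset.sum_eq_single τ (fun s _ hs => by simp [hs]) (fun h => absurd (Finset.mem_univ _) h)]
    simp [hστ, mul_assoc]
  have hs3 : ∀ f : FreqMomentum L M → Fin 2 → ℂ, ∑ p : FreqMomentum L M, ∑ s : Fin 2, ℓ p * (f p s * (if σ ≠ τ ∧ s = τ ∧ Q = p then cU else 0)) =
      ℓ Q * f Q τ * cU := by
    intro f
    rw [Finset.sum_eq_single Q (fun p _ hp => by simp [Ne.symm hp]) (fun h => absurd (Finset.mem_univ _) h),
      Finset.sum_eq_single τ (fun s _ hs => by simp [hs]) (fun h => absurd (Finset.mem_univ _) h)]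
    simp [hστ, mul_assoc]
  rw [hs0 (fun p s => kernel ℂ Wt 2 ![((p, s), 1), ((Kx, σ), 0)]), hs1 (fun p s => kernel ℂ Wt 2 ![((p, s), 0), ((Kx, σ), 1)]),
    hs2 (fun p s => kernel ℂ Wt 2 ![((p, s), 0), ((Q, τ), 1)]), hs3 (fun p s => kernel ℂ Wt 2 ![((p, s), 1), ((Q, τ), 0)]),
    kernel_two_swap01 Wt ((Kx, σ), 0) ((Kx, σ), 1), kernel_two_swap01 Wt ((Q, τ), 0) ((Q, τ), 1)]
  ring

end Trees

/-! ## §3 Assembly: the second cumulant's 4-leg kernel at the tadpole legs -/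

section Assembly

variable (β U : ℝ) (K : TrigPolyC4v) {C : Matrix (HubbardFieldIdx L M) (HubbardFieldIdx L M) ℂ} {ℓ : FreqMomentum L M → ℂ}

/-- **THE SECOND CUMULANT'S 4-LEG KERNEL AT THE TADPOLE LEGS `Z_{στ}(K,Q)`** (`contr C = diagContr ℓ`):
`kernel₄(e^{Δ_C}(WW) − (e^{Δ_C}W)²)(Z_{στ}) = trees − 24·(B_direct + B_pp − B_crossed)`
`= (σ = τ ? 48c_U²·Σ_pℓ(p)² : −8c_U·(ℓ(K)Σ̃(K,σ) + ℓ(Q)Σ̃(Q,τ)) − 48c_U²·S_pp(K,Q)) − 48c_U²·S_ph(K,Q)`. [cite: Salmhofer1999, §2.4] -/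
theorem kernel_four_secondCumulant_tadpoleLegs (hC : contr ℂ C = diagContr L M ℓ) (Kx Q : FreqMomentum L M) (σ τ : Fin 2) :
    kernel ℂ (gaussConv ℂ C (hubbardInteractionCT L M β U K * hubbardInteractionCT L M β U K) -
        gaussConv ℂ C (hubbardInteractionCT L M β U K) * gaussConv ℂ C (hubbardInteractionCT L M β U K)) 4
        (fun i => ((![Kx, Kx, Q, Q] i, ![σ, σ, τ, τ] i), (![0, 1, 1, 0] : Fin 4 → Fin 2) i)) =
      (if σ = τ then
          48 * ((((U / (β * (L : ℝ) ^ 2) ^ 3 : ℝ)) : ℂ) * (((4 : ℕ).factorial : ℚ)⁻¹ • (1 : ℂ))) ^ 2 * ∑ p : FreqMomentum L M, ℓ p * ℓ p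
        else
          -(8 * ((((U / (β * (L : ℝ) ^ 2) ^ 3 : ℝ)) : ℂ) * (((4 : ℕ).factorial : ℚ)⁻¹ • (1 : ℂ))) *
              (ℓ Kx * kernel ℂ (gaussConv ℂ C (hubbardInteractionCT L M β U K)) 2 ![((Kx, σ), 0), ((Kx, σ), 1)] +
                ℓ Q * kernel ℂ (gaussConv ℂ C (hubbardInteractionCT L M β U K)) 2 ![((Q, τ), 0), ((Q, τ), 1)])) -
            48 * ((((U / (β * (L : ℝ) ^ 2) ^ 3 : ℝ)) : ℂ) * (((4 : ℕ).factorial : ℚ)⁻¹ • (1 : ℂ))) ^ 2 *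
              ∑ p : FreqMomentum L M, ∑ p' : FreqMomentum L M,
                if matsubaraInt M p.1 + matsubaraInt M p'.1 = matsubaraInt M Kx.1 + matsubaraInt M Q.1 ∧ p.2 + p'.2 = Kx.2 + Q.2 then ℓ p * ℓ p' else 0) -
        48 * ((((U / (β * (L : ℝ) ^ 2) ^ 3 : ℝ)) : ℂ) * (((4 : ℕ).factorial : ℚ)⁻¹ • (1 : ℂ))) ^ 2 *
          ∑ p : FreqMomentum L M, ∑ p' : FreqMomentum L M,
            if matsubaraInt M p.1 + matsubaraInt M Q.1 = matsubaraInt M p'.1 + matsubaraInt M Kx.1 ∧ p.2 + Q.2 = p'.2 + Kx.2 then ℓ p * ℓ p' else 0 := by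
  rw [kernel_four_secondCumulant_hubbardInteractionCT_explicit]
  simp only [vecCons_four_apply_zero, vecCons_four_apply_one, vecCons_four_apply_two, vecCons_four_apply_three]
  rw [oneLine_tadpoleLegs β U K hC Kx Q σ τ]
  simp_rw [kernel_four_gaussConv_hubbardInteractionCT]
  rw [bubble_direct_tadpoleLegs β U hC Kx Q σ τ, bubble_pp_tadpoleLegs β U hC Kx Q σ τ, bubble_crossed_tadpoleLegs β U hC Kx Q σ τ]
  have h2 : ((2 : ℚ)⁻¹ • (1 : ℂ)) = (2 : ℂ)⁻¹ := by rw [Rat.smul_one_eq_cast]; push_cast; ring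
  rw [h2]
  by_cases hστ : σ = τ
  · simp only [hστ, if_true]
    push_cast [Nat.factorial]
    ring
  · simp only [hστ, if_false]
    push_cast [Nat.factorial]
    ring

/-- **Summed over the four spin configurations** (what the tadpole vertex reads, `…C4aTadpoleRepresentation.tadpoleVertex_latticeMomentum`):
`Σ_{σ,τ} kernel₄(2nd cumulant)(Z_{στ}(K,Q)) = 96c_U²·(Σ_p ℓ(p)² − S_pp(K,Q) − 2·S_ph(K,Q)) − 8c_U·(ℓ(K)·Σ_s Σ̃(K,s) + ℓ(Q)·Σ_s Σ̃(Q,s))`. [cite: Salmhofer1999, §2.4] -/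
theorem sum_kernel_four_secondCumulant_tadpoleLegs (hC : contr ℂ C = diagContr L M ℓ) (Kx Q : FreqMomentum L M) :
    ∑ σ : Fin 2, ∑ τ : Fin 2, kernel ℂ (gaussConv ℂ C (hubbardInteractionCT L M β U K * hubbardInteractionCT L M β U K) -
        gaussConv ℂ C (hubbardInteractionCT L M β U K) * gaussConv ℂ C (hubbardInteractionCT L M β U K)) 4
        (fun i => ((![Kx, Kx, Q, Q] i, ![σ, σ, τ, τ] i), (![0, 1, 1, 0] : Fin 4 → Fin 2) i)) =
      96 * ((((U / (β * (L : ℝ) ^ 2) ^ 3 : ℝ)) : ℂ) * (((4 : ℕ).factorial : ℚ)⁻¹ • (1 : ℂ))) ^ 2 *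
          (∑ p : FreqMomentum L M, ℓ p * ℓ p -
            ∑ p : FreqMomentum L M, ∑ p' : FreqMomentum L M,
              (if matsubaraInt M p.1 + matsubaraInt M p'.1 = matsubaraInt M Kx.1 + matsubaraInt M Q.1 ∧ p.2 + p'.2 = Kx.2 + Q.2 then ℓ p * ℓ p' else 0) -
            2 * ∑ p : FreqMomentum L M, ∑ p' : FreqMomentum L M,
              (if matsubaraInt M p.1 + matsubaraInt M Q.1 = matsubaraInt M p'.1 + matsubaraInt M Kx.1 ∧ p.2 + Q.2 = p'.2 + Kx.2 then ℓ p * ℓ p' else 0)) -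
        8 * ((((U / (β * (L : ℝ) ^ 2) ^ 3 : ℝ)) : ℂ) * (((4 : ℕ).factorial : ℚ)⁻¹ • (1 : ℂ))) *
          (ℓ Kx * ∑ s : Fin 2, kernel ℂ (gaussConv ℂ C (hubbardInteractionCT L M β U K)) 2 ![((Kx, s), 0), ((Kx, s), 1)] +
            ℓ Q * ∑ s : Fin 2, kernel ℂ (gaussConv ℂ C (hubbardInteractionCT L M β U K)) 2 ![((Q, s), 0), ((Q, s), 1)]) := by
  simp_rw [kernel_four_secondCumulant_tadpoleLegs β U K hC Kx Q]
  simp only [Fin.sum_univ_two, Fin.isValue, if_true, zero_ne_one, one_ne_zero, if_false]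
  ring

end Assembly

/-! ## §4 The continuum tadpole vertex of the second cumulant at lattice momenta -/

section Vertex

variable [NeZero M] (U : ℝ) (K : TrigPolyC4v) {C : Matrix (HubbardFieldIdx L M) (HubbardFieldIdx L M) ℂ} {ℓ : FreqMomentum L M → ℂ}

omit [NeZero L] in
/-- Reordering a triple spin/frequency-sign sum. -/
theorem sum_sum_sum_comm₃ (f : Fin 2 → Fin 2 → Fin 2 → ℂ) : ∑ σ : Fin 2, ∑ τ : Fin 2, ∑ κ : Fin 2, f σ τ κ = ∑ κ : Fin 2, ∑ σ : Fin 2, ∑ τ : Fin 2, f σ τ κ := by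
  simp only [Fin.sum_univ_two]
  ring

/-- **THE SECOND-ORDER TADPOLE VERTEX AT LATTICE MOMENTA** (`β ≠ 0`, `contr C = diagContr ℓ` — for the scale-`n` action take `C = klHardCov … n = C^K_{>Λ_n}` and
`ℓ(p) = χ_{Λ_n}(p)·βL²·ĝ_K(p)`, `…WickPairKernelDefs.contr_klHardCov_eq_diagContr`; `c_U = U(βL²)⁻³(4!)⁻¹`, `Σ̃(p,s) = kernel (e^{Δ_C}(V_U + 𝒩_K)) 2 (ψ̂⁺_{ps}, ψ̂⁻_{ps})`,
`K_κ = (κ, k⃗)` with `κ ∈ {ω₀, −ω₀}` the external frequency, `Q = (p₀, q⃗)` the loop label):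
`tadpoleVertex β (e^{Δ_C}(WW) − (e^{Δ_C}W)²) p₀ (p_k⃗) (p_q⃗) = 6βL⁴·Σ_κ [96c_U²·(Σ_pℓ(p)² − S_pp(K_κ,Q) − 2S_ph(K_κ,Q)) − 8c_U·(ℓ(K_κ)Σ_sΣ̃(K_κ,s) + ℓ(Q)Σ_sΣ̃(Q,s))]`
— the pp bubble `S_pp = Σ_{p,p′}[p + p′ ≐ K_κ + Q]ℓℓ′` at total `(κ + p₀, k⃗ + q⃗)`, the ph-crossed bubble `S_ph = Σ_{p,p′}[p + Q ≐ p′ + K_κ]ℓℓ′` at transfer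
`(κ − p₀, k⃗ − q⃗)`, a `(k⃗, q⃗)`-blind constant, and trees each depending on ONE of `k⃗`, `q⃗`. [cite: BenfattoGiulianiMastropietro2006, §2.3 (2.17)] -/
theorem tadpoleVertex_secondCumulant_latticeMomentum {β : ℝ} (hβ : β ≠ 0) (hC : contr ℂ C = diagContr L M ℓ) (p₀ : MatsubaraIdx M)
    (k q : TorusSite 2 L) :
    tadpoleVertex β (gaussConv ℂ C (hubbardInteractionCT L M β U K * hubbardInteractionCT L M β U K) -
        gaussConv ℂ C (hubbardInteractionCT L M β U K) * gaussConv ℂ C (hubbardInteractionCT L M β U K)) p₀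
        (WithLp.toLp 2 (latticeMomentum L k)) (WithLp.toLp 2 (latticeMomentum L q)) =
      ((6 * β * (L : ℝ) ^ 4 : ℝ) : ℂ) * ∑ κ : Fin 2,
        (96 * ((((U / (β * (L : ℝ) ^ 2) ^ 3 : ℝ)) : ℂ) * (((4 : ℕ).factorial : ℚ)⁻¹ • (1 : ℂ))) ^ 2 *
            (∑ p : FreqMomentum L M, ℓ p * ℓ p -
              ∑ p : FreqMomentum L M, ∑ p' : FreqMomentum L M,
                (if matsubaraInt M p.1 + matsubaraInt M p'.1 =
                      matsubaraInt M ((![omega0 M, (omega0 M).rev] : Fin 2 → MatsubaraIdx M) κ) + matsubaraInt M p₀ ∧ p.2 + p'.2 = k + q then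
                  ℓ p * ℓ p' else 0) -
              2 * ∑ p : FreqMomentum L M, ∑ p' : FreqMomentum L M,
                (if matsubaraInt M p.1 + matsubaraInt M p₀ = matsubaraInt M p'.1 + matsubaraInt M ((![omega0 M, (omega0 M).rev] : Fin 2 → MatsubaraIdx M) κ) ∧
                      p.2 + q = p'.2 + k then
                  ℓ p * ℓ p' else 0)) -
          8 * ((((U / (β * (L : ℝ) ^ 2) ^ 3 : ℝ)) : ℂ) * (((4 : ℕ).factorial : ℚ)⁻¹ • (1 : ℂ))) *
            (ℓ (((![omega0 M, (omega0 M).rev] : Fin 2 → MatsubaraIdx M) κ), k) *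
                ∑ s : Fin 2, kernel ℂ (gaussConv ℂ C (hubbardInteractionCT L M β U K)) 2
                  ![(((((![omega0 M, (omega0 M).rev] : Fin 2 → MatsubaraIdx M) κ), k), s), 0),
                    (((((![omega0 M, (omega0 M).rev] : Fin 2 → MatsubaraIdx M) κ), k), s), 1)] +
              ℓ (p₀, q) * ∑ s : Fin 2, kernel ℂ (gaussConv ℂ C (hubbardInteractionCT L M β U K)) 2 ![(((p₀, q), s), 0), (((p₀, q), s), 1)])) := by
  rw [tadpoleVertex_latticeMomentum hβ, sum_sum_sum_comm₃]
  congr 1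
  refine Finset.sum_congr rfl fun κ _ => ?_
  rw [sum_kernel_four_secondCumulant_tadpoleLegs β U K hC]

end Vertex

end Summit.HubbardSuperconductivity.HubbardSuperconductivity.Theorems.C4a

end
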